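import Literature.MathematicalPhysics.QuantumFieldTheory.Balaban1983to89.BlockAveragingPlaquetteBound
import Literature.MathematicalPhysics.QuantumFieldTheory.Balaban1983to89.BlockAveragingEMLHaarAC
import HarnessLib

/-!
# `FluctuationComparisonRegPrIntLOneBondGeometry` — SMALL FINE FIELDS SIT IN THE ONE-BOND CHART: the open holonomies, the private coordinate and the
# coarse bond value of a `PlaqSmall a` field all lie within `O(((d+2)L)²·a)` of one another

Cell `ym3-torus` (rung R3 = continuum `SU(2)` Yang–Mills on the three-torus — NOT d = 4, NOT infinite volume, NOT a mass gap, NOT Clay), width seat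
`ym-ust-20520-w5` (gen 21), pen (B1′) «Stage 1, part 3» (the GEOMETRIC side letters `hΩS` ∕ margin (M′) of LEAD-20520 w3 g22's triangular chart at `descend`,
2026-08-30): `--kind proof --supports stmt-QuantumFields-20520 --as helper`, count-neutral, definition-free, default heartbeats; THEOREMS ONLY (elementary
consequences of the tree's crude non-abelian Stokes bound `LatticeWordStokes.dist1_loopHol_le` and of `BlockAveragingPlaquetteBound.dist1_corr_le`); nothing
printed is asserted.

WHAT.  For Bałaban's block average [Balaban1987RG1] (0.4) (`BlockAveraging.avgFun ℰ U c = corr·axialAvg`, `axialAvg U c = pre·U(β c)·post`,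
`loopHol U c i = openHol U c i · (axialAvg U c)⁻¹`) on a fine field `U` with `PlaqSmall a U`, `t := (((d+2)L)²∕4)·a`:
* `norm_openHol_sub_axialAvg_le` — every open holonomy `V_i = openHol U c i` is within `t` of the straight transporter `W₀ := axialAvg U c` (= the one-bond map's
  argument `pre·g·post` at the field's own private coordinate `g = U(β c)`), in operator norm;
* `norm_openHol_sub_openHol_le` — the SPREAD of the environment at `c` is `≤ 2t`;
* `norm_avgFun_sub_axialAvg_le` — the coarse bond value `Ū(c)` is within `6t` of `W₀` (for `t < δ_N`), hence `norm_avgFun_sub_openHol_le`: within `7t` of every `V_i`.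
So with centre `V̄ := V_{i₀}`: spread `s ≤ 2t`, private-coordinate argument within `t ≤ ρ` of `V̄`, coarse value within `7t` of `V̄` — the membership letters `hΩS` and (M′) of the
one-bond chart (`…OneBondInverse`) reduce to the numeric side condition `7t < ` inner radius, i.e. `a ≤ c(d, L, N)`.

HONEST FRAMING: bookkeeping on the tree's own objects; nothing of `descend`'s level identification, VER∘, the (A)-package, COAREA∘, O1, crux stmt-QuantumFields-20520 or
`YM3TorusSU2` is proved here; no `def`, `instance`, `notation`, `sorry`.
-/

noncomputable section

open Set Function

namespace Summit.QuantumFields.YangMills.Theorems.FluctuationComparisonRegPrIntLOneBondGeometry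

open Literature.MathematicalPhysics.QuantumFieldTheory.Balaban1983to89
open T4Continuum AveragingRT BlockAveraging BlockAveragingHaarAC ExpMeanLog LatticeWordStokes
open scoped Matrix.Norms.L2Operator

variable {n : Type*} [Fintype n] [DecidableEq n] [Nonempty n] {P : Params} {j : ℕ}

omit [Nonempty n] in
/-- Elements of `SU(N)` are unitary matrices (file-private copy of a tree lemma, kept private to spare an import). [folklore] -/
private theorem coe_mem_unitaryGroup (g : Matrix.specialUnitaryGroup n ℂ) : (g : Matrix n n ℂ) ∈ Matrix.unitaryGroup n ℂ :=
  (Matrix.mem_specialUnitaryGroup_iff.1 g.2).1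

/-- In the matrix model `dist1 (V·W⁻¹) = ‖V − W‖` (right multiplication by the unitary `W*` is an isometry; file-private copy of a tree lemma). [folklore] -/
private theorem dist1_mul_inv_eq_norm_sub (V W : Matrix.specialUnitaryGroup n ℂ) :
    dist1 (V * W⁻¹) = ‖(V : Matrix n n ℂ) - (W : Matrix n n ℂ)‖ := by
  show ‖(V : Matrix n n ℂ) * star (W : Matrix n n ℂ) - 1‖ = _
  have e : (V : Matrix n n ℂ) * star (W : Matrix n n ℂ) - 1 = ((V : Matrix n n ℂ) - (W : Matrix n n ℂ)) * star (W : Matrix n n ℂ) := by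
    rw [sub_mul, Unitary.mul_star_self_of_mem (coe_mem_unitaryGroup W)]
  rw [e, CStarRing.norm_mul_mem_unitary _ (Unitary.star_mem (coe_mem_unitaryGroup W))]

/-- **EVERY OPEN HOLONOMY AT `c` IS WITHIN `t = (((d+2)L)²∕4)·a` OF THE STRAIGHT TRANSPORTER** `axialAvg U c = pre·U(β c)·post` when `PlaqSmall a U`
(the loop variable `V_i·(axialAvg)⁻¹` of (0.4) is within `t` of `1`: crude non-abelian Stokes, `LatticeWordStokes.dist1_loopHol_le`).
[cite: Balaban1985Averaging, (19)-(20) p.21; Balaban1987RG1, (0.4) p.253] -/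
theorem norm_openHol_sub_axialAvg_le {a : ℝ} (ha : 0 ≤ a) {U : GaugeField P j (Matrix.specialUnitaryGroup n ℂ)} (hU : PlaqSmall a U)
    (c : PBond P (j + 1)) (i : Idx P) :
    ‖((openHol U c i : Matrix.specialUnitaryGroup n ℂ) : Matrix n n ℂ) - ((axialAvg U c : Matrix.specialUnitaryGroup n ℂ) : Matrix n n ℂ)‖ ≤
      ((((P.d + 2) * P.L : ℕ) : ℝ) ^ 2 / 4) * a := by
  rw [← dist1_mul_inv_eq_norm_sub, ← loopHol_eq_openHol_mul]
  exact dist1_loopHol_le ha hU c i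

/-- **THE SPREAD OF THE ENVIRONMENT AT `c` IS `≤ 2t`**: any two open holonomies of a `PlaqSmall a` field differ by at most `2·(((d+2)L)²∕4)·a` in operator norm.
[cite: Balaban1985Averaging, (19)-(20) p.21; Balaban1987RG1, (0.4) p.253] -/
theorem norm_openHol_sub_openHol_le {a : ℝ} (ha : 0 ≤ a) {U : GaugeField P j (Matrix.specialUnitaryGroup n ℂ)} (hU : PlaqSmall a U)
    (c : PBond P (j + 1)) (i i' : Idx P) :
    ‖((openHol U c i : Matrix.specialUnitaryGroup n ℂ) : Matrix n n ℂ) - ((openHol U c i' : Matrix.specialUnitaryGroup n ℂ) : Matrix n n ℂ)‖ ≤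
      2 * (((((P.d + 2) * P.L : ℕ) : ℝ) ^ 2 / 4) * a) := by
  have h1 := norm_openHol_sub_axialAvg_le ha hU c i
  have h2 := norm_openHol_sub_axialAvg_le ha hU c i'
  rw [← sub_sub_sub_cancel_right _ _ ((axialAvg U c : Matrix.specialUnitaryGroup n ℂ) : Matrix n n ℂ)]
  calc _ ≤ _ := norm_sub_le _ _
    _ ≤ _ := by linarith

/-- **THE COARSE BOND VALUE IS WITHIN `6t` OF THE STRAIGHT TRANSPORTER**: `‖Ū(c) − axialAvg U c‖ = dist1 (corr) ≤ 6t` for `t < δ_N`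
(`BlockAveragingPlaquetteBound.dist1_corr_le`). [cite: Balaban1985Averaging, (26)-(27) p.22; Balaban1987RG1, (0.4) p.253] -/
theorem norm_avgFun_sub_axialAvg_le {a : ℝ} (ha : 0 ≤ a) {U : GaugeField P j (Matrix.specialUnitaryGroup n ℂ)} (hU : PlaqSmall a U)
    (ht : ((((P.d + 2) * P.L : ℕ) : ℝ) ^ 2 / 4) * a < deltaSU n) (c : PBond P (j + 1)) :
    ‖((avgFun (expMeanLogSU (n := n)) U c : Matrix.specialUnitaryGroup n ℂ) : Matrix n n ℂ) -
        ((axialAvg U c : Matrix.specialUnitaryGroup n ℂ) : Matrix n n ℂ)‖ ≤ 6 * (((((P.d + 2) * P.L : ℕ) : ℝ) ^ 2 / 4) * a) := by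
  have h := BlockAveragingPlaquetteBound.dist1_corr_le ha hU ht c
  have havg : avgFun (expMeanLogSU (n := n)) U c = corr (expMeanLogSU (n := n)) U c * axialAvg U c := rfl
  rw [havg, Submonoid.coe_mul]
  -- freeze the two group elements (no unfolding of `corr` ∕ `axialAvg` below)
  generalize hC : corr (expMeanLogSU (n := n)) U c = C at h ⊢
  generalize axialAvg U c = A
  have e : (C : Matrix n n ℂ) * (A : Matrix n n ℂ) - (A : Matrix n n ℂ) = ((C : Matrix n n ℂ) - 1) * (A : Matrix n n ℂ) := by
    rw [sub_mul, one_mul]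
  rw [e, CStarRing.norm_mul_mem_unitary _ (coe_mem_unitaryGroup A)]
  exact h

/-- **… HENCE WITHIN `7t` OF EVERY OPEN HOLONOMY** (in particular of the centre `V̄ = V_{i₀}` of the one-bond chart). [cite: Balaban1987RG1, (0.4) p.253] -/
theorem norm_avgFun_sub_openHol_le {a : ℝ} (ha : 0 ≤ a) {U : GaugeField P j (Matrix.specialUnitaryGroup n ℂ)} (hU : PlaqSmall a U)
    (ht : ((((P.d + 2) * P.L : ℕ) : ℝ) ^ 2 / 4) * a < deltaSU n) (c : PBond P (j + 1)) (i : Idx P) :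
    ‖((avgFun (expMeanLogSU (n := n)) U c : Matrix.specialUnitaryGroup n ℂ) : Matrix n n ℂ) -
        ((openHol U c i : Matrix.specialUnitaryGroup n ℂ) : Matrix n n ℂ)‖ ≤ 7 * (((((P.d + 2) * P.L : ℕ) : ℝ) ^ 2 / 4) * a) := by
  have h1 := norm_avgFun_sub_axialAvg_le ha hU ht c
  have h2 := norm_openHol_sub_axialAvg_le ha hU c i
  rw [← sub_sub_sub_cancel_right _ _ ((axialAvg U c : Matrix.specialUnitaryGroup n ℂ) : Matrix n n ℂ)]
  calc _ ≤ _ := norm_sub_le _ _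
    _ ≤ _ := by linarith

/-- **THE PRIVATE-COORDINATE ARGUMENT OF THE ONE-BOND MAP**: at the field's own private coordinate `g = U(β c)` the one-bond map's argument
`pre U c · g · post U c` IS the straight transporter `axialAvg U c` (`BlockAveragingHaarAC.axialAvg_eq_pre_mul_mul_post`), so it is within `t` of every
open holonomy. [cite: Balaban1987RG1, (0.4) p.253] -/
theorem norm_openHol_sub_pre_mul_mul_post_le {a : ℝ} (ha : 0 ≤ a) {U : GaugeField P j (Matrix.specialUnitaryGroup n ℂ)} (hU : PlaqSmall a U)
    (c : PBond P (j + 1)) (i : Idx P) :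
    ‖((openHol U c i : Matrix.specialUnitaryGroup n ℂ) : Matrix n n ℂ) -
        ((pre U c * U (centralBond c) * post U c : Matrix.specialUnitaryGroup n ℂ) : Matrix n n ℂ)‖ ≤ ((((P.d + 2) * P.L : ℕ) : ℝ) ^ 2 / 4) * a := by
  rw [← axialAvg_eq_pre_mul_mul_post]
  exact norm_openHol_sub_axialAvg_le ha hU c i

end Summit.QuantumFields.YangMills.Theorems.FluctuationComparisonRegPrIntLOneBondGeometry

end
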